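import Mathlib
import Literature.Combinatorics.Additive.TripleProductProperty
import Literature.Barriers.MatrixMultiplication.YoungSubgroupBarrierSTPP

/-!
# `SnSubsetDichotomy.GlobalBranch`, line `bregman-entropy-window` — stub `stub_hostedSubtriple`

Registered stub `stub_hostedSubtriple` of crux `stmt-MatrixMultiplication-8303`
(`Summit.MatrixMultiplication.MatrixMultiplication.Theses.SnSubsetDichotomy.GlobalBranch`), line
`bregman-entropy-window` (skeleton v7, the HOSTED case of the hosted / evasive split): the
bookkeeping that turns three sets of a TPP triple `S, T, U ⊆ 𝔖ₙ`, each meeting a right coset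
`C(μᵢ)·gᵢ` of the centraliser `C(μᵢ) = {σ : σ μᵢ = μᵢ σ}` of a permutation `μᵢ` in at least an
`e^{-c'√n}` fraction of its elements, into a HOSTED triple `Xᵢ ⊆ C(μᵢ)` with the triple product
property and volume `|X₀||X₁||X₂| ≥ e^{-3c'√n}·|S||T||U|`.  The lead's composition then feeds `X`
into the sibling crux `HyperoctahedralSubsets` (stmt-MatrixMultiplication-8305).

Proof (pure bookkeeping, Cohn–Umans 2003, §2): `σ ∈ C(μ)g ⇔ σg⁻¹ ∈ C(μ) ⇔ (σg⁻¹)μ = μ(σg⁻¹)`,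
which is the filter predicate of the hypotheses; put
`Xᵢ := {σ ∈ Sᵢ : (σgᵢ⁻¹)μᵢ = μᵢ(σgᵢ⁻¹)}·gᵢ⁻¹` (a `Finset.image` under right multiplication by
`gᵢ⁻¹`).  Then `Xᵢ ⊆ C(μᵢ)` by construction; the triple product property is hereditary
(`TripleProductProperty.mono`) and invariant under right translation of each set separately
(`(sa)(s'a)⁻¹ = ss'⁻¹`, tree lemma `tripleProductProperty_image_mul_right_iff`); right
multiplication is injective, so `|Xᵢ|` is the cardinality of the filtered part, and multiplying the
three hypotheses gives `|X₀||X₁||X₂| ≥ (e^{-c'√n})³|S||T||U| = e^{-3c'√n}|S||T||U|`.  No hypothesis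
on the `μᵢ` (nor on `c'`) is needed.
-/

-- `Summit.<Summit>.<Problem>` is the tree's mandated summit-side namespace; for this
-- single-conjunct summit the two coincide, so the file silences `dupNamespace`.
set_option linter.dupNamespace false
set_option autoImplicit false

namespace Summit.MatrixMultiplication.MatrixMultiplication.Theorems.GlobalBranch

open Literature.Combinatorics.Additive Literature.Barriers.MatrixMultiplication

/-- **Stub `stub_hostedSubtriple` (hosted sub-triple of a TPP triple).**  Let `S, T, U ⊆ 𝔖ₙ` have
the triple product property, and suppose that for permutations `μᵢ, gᵢ` (`i = 0, 1, 2`) each of the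
three sets meets the right coset `C(μᵢ)·gᵢ` of the centraliser `C(μᵢ) = {σ : σμᵢ = μᵢσ}` in at
least an `e^{-c'√n}` fraction of its elements (`σ ∈ C(μ)g ⇔ (σg⁻¹)μ = μ(σg⁻¹)`).  Then there is a
HOSTED triple `X₀ ⊆ C(μ₀)`, `X₁ ⊆ C(μ₁)`, `X₂ ⊆ C(μ₂)` with the triple product property and
`e^{-3c'√n}·|S||T||U| ≤ |X₀||X₁||X₂|`: take the right translates by `gᵢ⁻¹` of the parts of
`S, T, U` inside the cosets.  Why: the triple product property only involves the right quotient
sets `Q(S) = SS⁻¹`, which are unchanged by right translation (`(sa)(s'a)⁻¹ = ss'⁻¹`), and passes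
to subsets; right multiplication is a bijection, so the volume is the product of the three filtered
cardinalities, each at least `e^{-c'√n}` times the original, and `(e^{-c'√n})³ = e^{-3c'√n}`.
[cite: CohnUmans2003, §2] -/
theorem stub_hostedSubtriple : ∀ (n : ℕ) (c' : ℝ) (S T U : Finset (Equiv.Perm (Fin n)))
    (μ₀ μ₁ μ₂ g₀ g₁ g₂ : Equiv.Perm (Fin n)), TripleProductProperty S T U →
    Real.exp (-(c' * Real.sqrt (n : ℝ))) * (S.card : ℝ) ≤
      ((S.filter (fun σ => σ * g₀⁻¹ * μ₀ = μ₀ * (σ * g₀⁻¹))).card : ℝ) →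
    Real.exp (-(c' * Real.sqrt (n : ℝ))) * (T.card : ℝ) ≤
      ((T.filter (fun σ => σ * g₁⁻¹ * μ₁ = μ₁ * (σ * g₁⁻¹))).card : ℝ) →
    Real.exp (-(c' * Real.sqrt (n : ℝ))) * (U.card : ℝ) ≤
      ((U.filter (fun σ => σ * g₂⁻¹ * μ₂ = μ₂ * (σ * g₂⁻¹))).card : ℝ) →
    ∃ X : Fin 3 → Finset (Equiv.Perm (Fin n)),
      (∀ i, ∀ σ ∈ X i, σ * ![μ₀, μ₁, μ₂] i = ![μ₀, μ₁, μ₂] i * σ) ∧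
      TripleProductProperty (X 0) (X 1) (X 2) ∧
      Real.exp (-(3 * c' * Real.sqrt (n : ℝ))) * ((S.card * T.card * U.card : ℕ) : ℝ) ≤
        (((X 0).card * (X 1).card * (X 2).card : ℕ) : ℝ) := by
  intro n c' S T U μ₀ μ₁ μ₂ g₀ g₁ g₂ hTPP hS hT hU
  -- membership in a right translate of a filtered part gives the host (commutation) condition
  have host : ∀ (Y : Finset (Equiv.Perm (Fin n))) (μ g : Equiv.Perm (Fin n)),
      ∀ σ ∈ (Y.filter (fun σ => σ * g⁻¹ * μ = μ * (σ * g⁻¹))).image (· * g⁻¹), σ * μ = μ * σ := by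
    intro Y μ g σ hσ
    simp only [Finset.mem_image, Finset.mem_filter] at hσ
    obtain ⟨τ, ⟨-, hτ⟩, rfl⟩ := hσ
    exact hτ
  refine ⟨![(S.filter (fun σ => σ * g₀⁻¹ * μ₀ = μ₀ * (σ * g₀⁻¹))).image (· * g₀⁻¹),
    (T.filter (fun σ => σ * g₁⁻¹ * μ₁ = μ₁ * (σ * g₁⁻¹))).image (· * g₁⁻¹),
    (U.filter (fun σ => σ * g₂⁻¹ * μ₂ = μ₂ * (σ * g₂⁻¹))).image (· * g₂⁻¹)], ?_, ?_, ?_⟩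
  · -- the three translates are hosted by `C(μ₀)`, `C(μ₁)`, `C(μ₂)`
    intro i
    fin_cases i
    · exact host S μ₀ g₀
    · exact host T μ₁ g₁
    · exact host U μ₂ g₂
  · -- the triple product property is hereditary and right-translation invariant
    exact (tripleProductProperty_image_mul_right_iff _ _ _ g₀⁻¹ g₁⁻¹ g₂⁻¹).2
      (hTPP.mono (Finset.filter_subset _ _) (Finset.filter_subset _ _) (Finset.filter_subset _ _))
  · -- volume: right multiplication is injective, then multiply the three lower bounds
    simp only [Matrix.cons_val_zero, Matrix.cons_val_one, Matrix.head_cons, Matrix.cons_val_two,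
      Matrix.tail_cons, Finset.card_image_of_injective _ (mul_left_injective _)]
    push_cast
    have h3 : Real.exp (-(3 * c' * Real.sqrt (n : ℝ))) = Real.exp (-(c' * Real.sqrt (n : ℝ))) ^ 3 := by
      rw [← Real.exp_nat_mul]
      congr 1
      push_cast
      ring
    rw [h3]
    calc Real.exp (-(c' * Real.sqrt (n : ℝ))) ^ 3 * ((S.card : ℝ) * (T.card : ℝ) * (U.card : ℝ))
        = Real.exp (-(c' * Real.sqrt (n : ℝ))) * (S.card : ℝ) *
            (Real.exp (-(c' * Real.sqrt (n : ℝ))) * (T.card : ℝ)) *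
            (Real.exp (-(c' * Real.sqrt (n : ℝ))) * (U.card : ℝ)) := by ring
      _ ≤ ((S.filter (fun σ => σ * g₀⁻¹ * μ₀ = μ₀ * (σ * g₀⁻¹))).card : ℝ) *
            ((T.filter (fun σ => σ * g₁⁻¹ * μ₁ = μ₁ * (σ * g₁⁻¹))).card : ℝ) *
            ((U.filter (fun σ => σ * g₂⁻¹ * μ₂ = μ₂ * (σ * g₂⁻¹))).card : ℝ) :=
        mul_le_mul (mul_le_mul hS hT (by positivity) (by positivity)) hU (by positivity)
          (by positivity)

end Summit.MatrixMultiplication.MatrixMultiplication.Theorems.GlobalBranch
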